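import Literature.AlgebraicGeometry.Modules.FiniteTypeLocal
import Literature.AlgebraicGeometry.Modules.CechBaseChangeHom
import Literature.AlgebraicGeometry.Modules.PullbackQuasicoherent
import Literature.AlgebraicGeometry.Modules.PullbackFlatMono
import Literature.RingTheory.FittingIdeal.Localization
import Literature.RingTheory.FittingIdeal.BaseChange
import Literature.RingTheory.FittingIdeal.Monotone
import Mathlib.AlgebraicGeometry.IdealSheaf.Functorial
import HarnessLib

/-!
# The Fitting ideal sheaves of a finite type quasi-coherent module, and their base change

Topic `Literature/AlgebraicGeometry/Modules`, namespace `Literature.AlgebraicGeometry.Modules`.  ONE definition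
(`fittingIdealSheaf`), theorems otherwise; no instance, no notation, no named fact, no `sorry`.

The Stacks Project, Tag 0C3C (Divisors, Section 31.9): "Let `S` be a scheme. Let `F` be a finite type
quasi-coherent `𝒪_S`-module. In this situation we can construct the Fitting ideals
`0 = Fit_{-1}(F) ⊂ Fit_0(F) ⊂ Fit_1(F) ⊂ … ⊂ 𝒪_S` as the sequence of quasi-coherent ideals characterized by the
following property: for every affine open `U = Spec(A)` of `S` if `F|_U` corresponds to the `A`-module `M`, then
`Fit_i(F)|_U` corresponds to the ideal `Fit_i(M) ⊂ A`. This is well defined and a quasi-coherent sheaf of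
ideals because if `f ∈ A`, then the `i`th Fitting ideal of `M_f` over `A_f` is equal to `Fit_i(M) A_f` by More on
Algebra, Lemma 15.8.4."  and Tag 0C3D (Lemma 31.9.1): "Let `f : T → S` be a morphism of schemes. Let `F` be a
finite type quasi-coherent `𝒪_S`-module. Then `f⁻¹Fit_i(F) · 𝒪_T = Fit_i(f^*F)`."

In the tree's affine-local currency — `IsAffineLocalizing M` (★ `Modules/AffineLocalizing`, = quasi-coherent,
★ `IsAffineLocalizing.of_isQuasicoherent`) and `IsAffineFiniteType M` (★ `Modules/FiniteType`) — and Mathlib's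
`Scheme.IdealSheafData` (ideals on affine opens compatible with basic opens), exactly as ★
`Morphisms/FittingIdealSheaf` does for the special case `f_*𝒪_X` of a finite morphism:

* §1 **`fittingIdealSheaf M hM hfin r : X.IdealSheafData`** (`Fit_r(M)`, 0C3C; the compatibility with
  basic opens is ★ `Module.fittingIdeal_of_isLocalizedModule` + ★ `IsAffineLocalizing.isLocalizedModule_basicOpen`),
  `ideal_fittingIdealSheaf`, `fittingIdealSheaf_mono`, `fittingIdealSheaf_eq_of_iso`.
* §2 PULL-BACK: `IsAffineFiniteType.pullback` (finite type is preserved by `f^*`), and the affine-chart form of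
  0C3D **`fittingIdeal_sections_pullback`** / **`ideal_fittingIdealSheaf_pullback`**: for affine `U ⊆ f⁻¹V`,
  `Fit_r(Γ(U, f^*M)) = Fit_r(Γ(V, M)) · Γ(U, 𝒪_X)` (★ `CechBaseChangeHom.isBaseChange_unitSectionLE`:
  `Γ(U, f^*M) = Γ(U) ⊗_{Γ(V)} Γ(V, M)`, and ★ `Module.fittingIdeal_baseChange`, Stacks 07ZA (3)).
* §3 the two consequences of 0C3D consumed by the representability of the rank loci (Stacks 05P8):
  **`fittingIdealSheaf_pullback_eq_bot_iff`** — `Fit_r(f^*M) = 0 ↔ Fit_r(M) ≤ ker f` (a CLOSED condition on `f`),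
  **`coe_support_fittingIdealSheaf_pullback`** — `Supp(𝒪/Fit_r(f^*M)) = f⁻¹ Supp(𝒪/Fit_r(M))`, and
  **`fittingIdealSheaf_pullback_eq_top_iff`** — `Fit_r(f^*M) = 𝒪_X ↔ f(X) ⊆ S ∖ Z_r` (an OPEN condition).

Cell `hodgecm-mathlib` (D-0151) count-neutral Mathlib-side capital (F-DAG F-5 (5b)/(5d): flattening
stratification, `Hilb ↪ Grass`); nothing here is about HC — HC_CM is proved only modulo the 7 printed citations
until rung 0 closes.

## References

* The Stacks Project, Tags 0C3C, 0C3D (Divisors §31.9), 07ZA (More on Algebra, Lemma 15.8.4). [StacksProject]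
* R. Hartshorne, *Algebraic Geometry*, GTM 52 (1977), II Prop. 5.2 (e), Lemma 5.3, Prop. 5.4 (pp. 110–113).
  [Hartshorne1977]
-/

noncomputable section

-- `TopCat.Presheaf`/`Scheme.Modules` are not reducible (as in Mathlib's `AlgebraicGeometry/Modules`).
set_option backward.isDefEq.respectTransparency false

open CategoryTheory AlgebraicGeometry TopologicalSpace Opposite TensorProduct

universe u

namespace Literature.AlgebraicGeometry.Modules

open Literature.RingTheory.FittingIdeal

/-! ## §1 The Fitting ideal sheaves `Fit_r(M)` -/

section Def

variable {X : Scheme.{u}} (M : X.Modules)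

/-- **Fitting ideals of sections commute with basic opens**: for `M` affine-localizing of affine-finite type,
`V` affine and `g ∈ Γ(V, 𝒪_X)`, `Fit_r(Γ(D(g), M)) = Fit_r(Γ(V, M)) · Γ(D(g), 𝒪_X)` — `Γ(D(g), M)` is the
localisation of `Γ(V, M)` at `g` (Hartshorne II Lemma 5.3) and Fitting ideals commute with localisation
(Stacks 07ZA (3)). [cite: StacksProject, Tag 0C3C] [cite: StacksProject, Tag 07ZA] -/
theorem fittingIdeal_sections_basicOpen (hM : IsAffineLocalizing M) (hfin : IsAffineFiniteType M)
    (V : X.affineOpens) (g : Γ(X, V)) (r : ℕ) :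
    Module.fittingIdeal Γ(X, X.basicOpen g) Γ(M, X.basicOpen g) r =
      (Module.fittingIdeal Γ(X, V) Γ(M, V) r).map (X.presheaf.map (homOfLE (X.basicOpen_le g)).op).hom := by
  letI := moduleBasicOpen M g
  haveI := isScalarTower_basicOpen M g
  haveI : Module.Finite Γ(X, V) Γ(M, V) := hfin V.2
  haveI := V.2.isLocalization_basicOpen g
  haveI := hM.isLocalizedModule_basicOpen g V.2
  exact Module.fittingIdeal_of_isLocalizedModule (Submonoid.powers g) Γ(X, X.basicOpen g)
    (resBasicOpen M g) r

/-- **The `r`-th Fitting ideal sheaf `Fit_r(M)`** of an affine-localizing (= quasi-coherent) `𝒪_X`-module of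
affine-finite type: the quasi-coherent ideal sheaf whose ideal of sections over an affine open `V` is the `r`-th
Fitting ideal of the finite `Γ(V, 𝒪_X)`-module `Γ(V, M)`. [cite: StacksProject, Tag 0C3C] -/
def fittingIdealSheaf (hM : IsAffineLocalizing M) (hfin : IsAffineFiniteType M) (r : ℕ) : X.IdealSheafData where
  ideal V := Module.fittingIdeal Γ(X, V) Γ(M, V) r
  map_ideal_basicOpen V g := (fittingIdeal_sections_basicOpen M hM hfin V g r).symm

variable {M}

/-- The ideal of sections of `Fit_r(M)` over an affine open (definitional). [cite: StacksProject, Tag 0C3C] -/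
theorem ideal_fittingIdealSheaf (hM : IsAffineLocalizing M) (hfin : IsAffineFiniteType M) (r : ℕ)
    (V : X.affineOpens) :
    (fittingIdealSheaf M hM hfin r).ideal V = Module.fittingIdeal Γ(X, V) Γ(M, V) r := rfl

/-- `Fit_r(M) ⊆ Fit_{r'}(M)` for `r ≤ r'`. [cite: StacksProject, Tag 0C3C] [cite: StacksProject, Tag 07ZA] -/
theorem fittingIdealSheaf_mono (hM : IsAffineLocalizing M) (hfin : IsAffineFiniteType M) {r r' : ℕ}
    (h : r ≤ r') : fittingIdealSheaf M hM hfin r ≤ fittingIdealSheaf M hM hfin r' :=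
  fun _ => Module.fittingIdeal_mono h

/-- The sections of isomorphic modules over an open are isomorphic `Γ(V, 𝒪_X)`-modules (plumbing). [folklore] -/
private def sectionsLinearEquiv {M N : X.Modules} (e : M ≅ N) (V : X.Opens) :
    Γ(M, V) ≃ₗ[Γ(X, V)] Γ(N, V) :=
  { appLinear e.hom V with
    invFun := appLinear e.inv V
    left_inv := fun m => inv_app_hom_app e V m
    right_inv := fun n => hom_app_inv_app e V n }

/-- **`Fit_r` only depends on the isomorphism class of the module.** [cite: StacksProject, Tag 0C3C] -/
theorem fittingIdealSheaf_eq_of_iso {M N : X.Modules} (e : M ≅ N) (hM : IsAffineLocalizing M)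
    (hfinM : IsAffineFiniteType M) (hN : IsAffineLocalizing N) (hfinN : IsAffineFiniteType N) (r : ℕ) :
    fittingIdealSheaf M hM hfinM r = fittingIdealSheaf N hN hfinN r := by
  refine Scheme.IdealSheafData.ext (funext fun V => ?_)
  exact Module.fittingIdeal_eq_of_linearEquiv (sectionsLinearEquiv e V) r

/-- For `r` at least the number of generators of `Γ(V, M)`, `Fit_r(M)(V) = Γ(V, 𝒪_X)` — so over every affine
open some Fitting ideal is the unit ideal (Stacks 05P8 (1): `⋂_r Z_r = ∅`). [cite: StacksProject, Tag 05P8] -/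
theorem exists_ideal_fittingIdealSheaf_eq_top (hM : IsAffineLocalizing M) (hfin : IsAffineFiniteType M)
    (V : X.affineOpens) : ∃ r : ℕ, (fittingIdealSheaf M hM hfin r).ideal V = ⊤ := by
  haveI : Module.Finite Γ(X, V) Γ(M, V) := hfin V.2
  obtain ⟨n, x, hx⟩ := Module.Finite.exists_fin (R := Γ(X, V)) (M := Γ(M, V))
  exact ⟨n, Module.fittingIdeal_eq_top_of_span_eq_top x hx⟩

end Def

/-! ## §2 Pull-back: `Fit_r(Γ(U, f^*M)) = Fit_r(Γ(V, M)) · Γ(U, 𝒪_X)` on affine charts (0C3D) -/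

section Pullback

variable {X Y : Scheme.{u}} (f : X ⟶ Y) {M : Y.Modules}

/-- **Finite type is preserved by inverse image**: for `M` affine-localizing of affine-finite type, `f^*M` is of
affine-finite type (on an affine `U ⊆ f⁻¹V`, `Γ(U, f^*M) = Γ(U) ⊗_{Γ(V)} Γ(V, M)` is finitely generated; such
`U` form a basis and finite type is affine-local, ★ `IsAffineFiniteType.of_basis`).
[cite: Hartshorne1977, II Prop. 5.8 (b) (p. 115)] -/
theorem IsAffineFiniteType.pullback (hM : IsAffineLocalizing M) (hfin : IsAffineFiniteType M) :
    IsAffineFiniteType ((Scheme.Modules.pullback f).obj M) := by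
  refine IsAffineFiniteType.of_basis (hM.pullback f) fun x O hxO => ?_
  obtain ⟨U, ⟨hU, V, hV, i⟩, hxU, hUO⟩ :=
    (Opens.isBasis_iff_nbhd.mp (isBasis_affineOpens_le_preimage f)) hxO
  refine ⟨U, hU, hxU, hUO, ?_⟩
  letI := (f.appLE V U i).hom.toAlgebra
  letI : Module Γ(Y, V) Γ((Scheme.Modules.pullback f).obj M, U) := Module.compHom _ (f.appLE V U i).hom
  haveI : IsScalarTower Γ(Y, V) Γ(X, U) Γ((Scheme.Modules.pullback f).obj M, U) :=
    ⟨fun a b x => mul_smul ((f.appLE V U i).hom a) b x⟩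
  haveI : Module.Finite Γ(Y, V) Γ(M, V) := hfin hV
  have h := isBaseChange_unitSectionLE f M i hV hU hM
  exact Module.Finite.equiv h.equiv

/-- **Stacks 0C3D on affine charts**: for `M` affine-localizing of affine-finite type on `Y`, `f : X → Y`, and
affine opens `U ⊆ f⁻¹V`: `Fit_r(Γ(U, f^*M)) = Fit_r(Γ(V, M)) · Γ(U, 𝒪_X)` — `Γ(U, f^*M)` is the base change
`Γ(U) ⊗_{Γ(V)} Γ(V, M)` (GW I Prop. 7.24 (2)) and Fitting ideals commute with base change (07ZA (3)).
[cite: StacksProject, Tag 0C3D] [cite: StacksProject, Tag 07ZA] -/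
theorem fittingIdeal_sections_pullback (hM : IsAffineLocalizing M) (hfin : IsAffineFiniteType M)
    {V : Y.Opens} (hV : IsAffineOpen V) {U : X.Opens} (hU : IsAffineOpen U) (i : U ≤ f ⁻¹ᵁ V) (r : ℕ) :
    Module.fittingIdeal Γ(X, U) Γ((Scheme.Modules.pullback f).obj M, U) r =
      (Module.fittingIdeal Γ(Y, V) Γ(M, V) r).map (f.appLE V U i).hom := by
  letI := (f.appLE V U i).hom.toAlgebra
  letI : Module Γ(Y, V) Γ((Scheme.Modules.pullback f).obj M, U) := Module.compHom _ (f.appLE V U i).hom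
  haveI : IsScalarTower Γ(Y, V) Γ(X, U) Γ((Scheme.Modules.pullback f).obj M, U) :=
    ⟨fun a b x => mul_smul ((f.appLE V U i).hom a) b x⟩
  haveI : Module.Finite Γ(Y, V) Γ(M, V) := hfin hV
  have h := isBaseChange_unitSectionLE f M i hV hU hM
  rw [← Module.fittingIdeal_eq_of_linearEquiv h.equiv r, Module.fittingIdeal_baseChange]
  rfl

/-- **Stacks 0C3D for the Fitting ideal sheaves, on affine charts**: for affine `U ⊆ f⁻¹V`,
`Fit_r(f^*M)(U) = Fit_r(M)(V) · Γ(U, 𝒪_X)`. [cite: StacksProject, Tag 0C3D] -/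
theorem ideal_fittingIdealSheaf_pullback (hM : IsAffineLocalizing M) (hfin : IsAffineFiniteType M)
    (V : Y.affineOpens) (U : X.affineOpens) (i : (U : X.Opens) ≤ f ⁻¹ᵁ (V : Y.Opens)) (r : ℕ) :
    (fittingIdealSheaf _ (hM.pullback f) (hfin.pullback f hM) r).ideal U =
      ((fittingIdealSheaf M hM hfin r).ideal V).map (f.appLE V U i).hom :=
  fittingIdeal_sections_pullback f hM hfin V.2 U.2 i r

/-! ## §3 `Fit_r(f^*M) = 0` is a closed condition and `Fit_r(f^*M) = 𝒪` an open condition on `f` -/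

/-- The affine opens of `X` mapping into an affine open of `Y` cover `X`. [cite: GortzWedhorn2020, Prop. 3.2 (affine open subschemes form a basis)] -/
theorem iSup_affineOpens_le_preimage_eq_top :
    ⨆ U : {U : X.affineOpens // ∃ V : Y.affineOpens, (U : X.Opens) ≤ f ⁻¹ᵁ (V : Y.Opens)},
      (U.1 : X.Opens) = ⊤ := by
  refine top_le_iff.mp fun x _ => ?_
  obtain ⟨U, ⟨hU, V, hV, i⟩, hxU, -⟩ :=
    (Opens.isBasis_iff_nbhd.mp (isBasis_affineOpens_le_preimage f)) (show x ∈ (⊤ : X.Opens) from trivial)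
  exact Opens.mem_iSup.mpr ⟨⟨⟨U, hU⟩, ⟨V, hV⟩, i⟩, hxU⟩

/-- **`Fit_r(f^*M) = 0` iff `Fit_r(M) ⊆ ker(𝒪_Y → f_*𝒪_X)`** (0C3D: `Fit_r(f^*M) = f⁻¹Fit_r(M) · 𝒪_X`; a closed
condition on `f`, in the currency of Mathlib's `Scheme.Hom.ker`). [cite: StacksProject, Tag 0C3D]
[cite: StacksProject, Tag 05P8] -/
theorem fittingIdealSheaf_pullback_eq_bot_iff (hM : IsAffineLocalizing M) (hfin : IsAffineFiniteType M)
    (r : ℕ) :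
    fittingIdealSheaf _ (hM.pullback f) (hfin.pullback f hM) r = ⊥ ↔ fittingIdealSheaf M hM hfin r ≤ f.ker := by
  constructor
  · intro h
    -- `Fit_r(M)(V) ⊆ ker (f♯ : Γ(V) → Γ(f⁻¹V))`: a section dying on an affine cover of `f⁻¹V` is zero
    refine Scheme.IdealSheafData.le_ofIdeals_iff.mpr fun V a ha => ?_
    rw [RingHom.mem_ker]
    -- the affine opens of `f⁻¹V` (they cover it)
    let ι := {U : X.affineOpens // (U : X.Opens) ≤ f ⁻¹ᵁ (V : Y.Opens)}
    have hcov : f ⁻¹ᵁ (V : Y.Opens) ≤ ⨆ U : ι, (U.1 : X.Opens) := fun x hx => by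
      obtain ⟨U, hU, hxU, hUle⟩ := (Opens.isBasis_iff_nbhd.mp X.isBasis_affineOpens) hx
      exact Opens.mem_iSup.mpr ⟨⟨⟨U, hU⟩, hUle⟩, hxU⟩
    refine X.sheaf.eq_of_locally_eq' (fun U : ι => (U.1 : X.Opens)) (f ⁻¹ᵁ (V : Y.Opens))
      (fun U => homOfLE U.2) hcov _ _ fun U => ?_
    rw [map_zero]
    have hU : f.appLE V U.1 U.2 a ∈ (fittingIdealSheaf _ (hM.pullback f) (hfin.pullback f hM) r).ideal U.1 := by
      rw [ideal_fittingIdealSheaf_pullback f hM hfin V U.1 U.2 r]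
      exact Ideal.mem_map_of_mem _ ha
    rw [h, Scheme.IdealSheafData.ideal_bot, Pi.bot_apply, Ideal.mem_bot] at hU
    exact hU
  · intro h
    refine le_bot_iff.mp (Scheme.IdealSheafData.le_of_iSup_eq_top _
      (iSup_affineOpens_le_preimage_eq_top f) fun U => ?_)
    obtain ⟨V, i⟩ := U.2
    rw [ideal_fittingIdealSheaf_pullback f hM hfin V U.1 i r, Scheme.IdealSheafData.ideal_bot, Pi.bot_apply,
      le_bot_iff, Ideal.map_eq_bot_iff_le_ker]
    intro a ha
    have ha' : a ∈ RingHom.ker (f.app V).hom := (f.ideal_ker_le V) (h V ha)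
    rw [RingHom.mem_ker] at ha' ⊢
    rw [Scheme.Hom.appLE, CommRingCat.comp_apply, ha', map_zero]

/-- **The support of `𝒪_X/Fit_r(f^*M)` is the preimage of the support of `𝒪_Y/Fit_r(M)`** (0C3D pointwise:
`Z_r(f^*M) = f⁻¹Z_r(M)` set-theoretically). [cite: StacksProject, Tag 0C3D] [cite: StacksProject, Tag 05P8] -/
theorem coe_support_fittingIdealSheaf_pullback (hM : IsAffineLocalizing M) (hfin : IsAffineFiniteType M)
    (r : ℕ) :
    ((fittingIdealSheaf _ (hM.pullback f) (hfin.pullback f hM) r).support : Set X) =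
      f.base ⁻¹' (fittingIdealSheaf M hM hfin r).support := by
  ext x
  obtain ⟨U, ⟨hU, V, hV, i⟩, hxU, -⟩ :=
    (Opens.isBasis_iff_nbhd.mp (isBasis_affineOpens_le_preimage f)) (show x ∈ (⊤ : X.Opens) from trivial)
  have hxV : f.base x ∈ (V : Set Y) := i hxU
  rw [Set.mem_preimage, SetLike.mem_coe, SetLike.mem_coe,
    Scheme.IdealSheafData.mem_support_iff_of_mem (U := ⟨U, hU⟩) hxU,
    Scheme.IdealSheafData.mem_support_iff_of_mem (U := ⟨V, hV⟩) hxV,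
    ideal_fittingIdealSheaf_pullback f hM hfin ⟨V, hV⟩ ⟨U, hU⟩ i r, Ideal.map, Scheme.zeroLocus_span,
    Scheme.mem_zeroLocus_iff, Scheme.mem_zeroLocus_iff]
  constructor
  · rintro h a ha hxa
    refine h (f.appLE V U i a) ⟨a, ha, rfl⟩ ?_
    rw [Scheme.basicOpen_appLE]
    exact ⟨hxU, hxa⟩
  · rintro h _ ⟨a, ha, rfl⟩ hxa
    rw [Scheme.basicOpen_appLE] at hxa
    exact h a ha hxa.2

/-- **`Fit_r(f^*M) = 𝒪_X` iff `f(X)` misses `Z_r = Supp(𝒪_Y/Fit_r(M))`** (an open condition on `f`).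
[cite: StacksProject, Tag 0C3D] [cite: StacksProject, Tag 05P8] -/
theorem fittingIdealSheaf_pullback_eq_top_iff (hM : IsAffineLocalizing M) (hfin : IsAffineFiniteType M)
    (r : ℕ) :
    fittingIdealSheaf _ (hM.pullback f) (hfin.pullback f hM) r = ⊤ ↔
      Set.range f.base ⊆ ((fittingIdealSheaf M hM hfin r).support : Set Y)ᶜ := by
  rw [← Scheme.IdealSheafData.support_eq_bot_iff, ← SetLike.coe_set_eq, Closeds.coe_bot,
    coe_support_fittingIdealSheaf_pullback f hM hfin r, Set.preimage_eq_empty_iff,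
    Set.subset_compl_iff_disjoint_right, disjoint_comm]

end Pullback

end Literature.AlgebraicGeometry.Modules

end
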